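import Mathlib
import Literature.Analysis.Calculus.TwoVariablePartials
import HarnessLib

/-!
# `∂_t² ∂ₓ = ∂ₓ ∂_t²` for `C³` functions of two real variables (curried form)

Analysis/Calculus support file (everything proved). For `φ : ℝ → ℝ → ℝ` (time first) with
`ContDiff ℝ 3 (uncurry φ)`, `exists_partial_x_of_contDiff_three` produces the `x`-partial `φx`
(jointly `C²`, `∂ₓ(φ t) = φx t`) together with the third-order exchange identity in the one-variable
language of the tree's 1+1 wave items:

  `iteratedDeriv 2 (fun τ => φx τ x) t = deriv (fun y => iteratedDeriv 2 (fun τ => φ τ y) t) x`,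

i.e. `∂_t²∂ₓφ = ∂ₓ∂_t²φ`, and `iteratedDeriv 2 (φx t) x = iteratedDeriv 3 (φ t) x`. Proof: three
applications of the `C²` dictionary `exists_partials_of_contDiff_two` (to `φ`, `∂ₜφ`, `∂ₓφ`) glued by
uniqueness of derivatives — no higher symmetric-multilinear bookkeeping. Used by the intertwining
operators `∂ₓ − k/x` between inverse-square wave equations (route PhotonSphereChannels,
`FixedModeChannels`, stmt-FinalStateConjecture-10048). Folklore.
-/

noncomputable section

namespace Literature.Analysis.Calculus

open Set Filter Topology

variable {φ : ℝ → ℝ → ℝ}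

/-- **The `x`-partial of a `C³` function and the exchange `∂_t²∂ₓ = ∂ₓ∂_t²`.** [folklore] -/
theorem exists_partial_x_of_contDiff_three (hφ : ContDiff ℝ 3 (Function.uncurry φ)) :
    ∃ φx : ℝ → ℝ → ℝ, ContDiff ℝ 2 (Function.uncurry φx) ∧
      (∀ t x, HasDerivAt (φ t) (φx t x) x) ∧
      (∀ t, deriv (φ t) = φx t) ∧
      (∀ t x, iteratedDeriv 2 (φx t) x = iteratedDeriv 3 (φ t) x) ∧
      (∀ t x, iteratedDeriv 2 (fun τ => φx τ x) t
          = deriv (fun y => iteratedDeriv 2 (fun τ => φ τ y) t) x) := by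
  set f : ℝ × ℝ → ℝ := Function.uncurry φ with hf
  have hfd : Differentiable ℝ f := hφ.differentiable (by norm_num)
  have hD2 : ContDiff ℝ 2 (fderiv ℝ f) := hφ.fderiv_right (by norm_num)
  -- the two first partials as `fderiv` applications; both jointly `C²`
  set Φt : ℝ → ℝ → ℝ := fun t x => fderiv ℝ f (t, x) (1, 0) with hΦt
  set Φx : ℝ → ℝ → ℝ := fun t x => fderiv ℝ f (t, x) (0, 1) with hΦx
  have hΦtC2 : ContDiff ℝ 2 (Function.uncurry Φt) :=
    (hD2.clm_apply contDiff_const : ContDiff ℝ 2 fun p : ℝ × ℝ => fderiv ℝ f p (1, 0))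
  have hΦxC2 : ContDiff ℝ 2 (Function.uncurry Φx) :=
    (hD2.clm_apply contDiff_const : ContDiff ℝ 2 fun p : ℝ × ℝ => fderiv ℝ f p (0, 1))
  have cτ : ∀ t x : ℝ, HasDerivAt (fun τ : ℝ => (τ, x)) ((1 : ℝ), (0 : ℝ)) t := fun t x =>
    (hasDerivAt_id t).prodMk (hasDerivAt_const t x)
  have cy : ∀ t x : ℝ, HasDerivAt (fun y : ℝ => (t, y)) ((0 : ℝ), (1 : ℝ)) x := fun t x =>
    (hasDerivAt_const x t).prodMk (hasDerivAt_id x)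
  have hΦt_d : ∀ t x, HasDerivAt (fun τ => φ τ x) (Φt t x) t := fun t x => by
    have h := (hfd (t, x)).hasFDerivAt.comp_hasDerivAt t (cτ t x)
    exact h
  have hΦx_d : ∀ t x, HasDerivAt (φ t) (Φx t x) x := fun t x => by
    have h := (hfd (t, x)).hasFDerivAt.comp_hasDerivAt x (cy t x)
    exact h
  -- the `C²` dictionaries of `φ`, `Φt`, `Φx`
  have hφC2 : ContDiff ℝ 2 f := hφ.of_le (by norm_num)
  obtain ⟨φt₁, φx₁, -, φtx₁, -, -, -, -, -, -, h1, h2, -, h4, h5, -, -, -⟩ :=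
    exists_partials_of_contDiff_two hφC2
  obtain ⟨Tt, Tx, -, Ttx, -, -, -, -, -, -, hT1, hT2, -, hT4, hT5, -, -, -⟩ :=
    exists_partials_of_contDiff_two hΦtC2
  obtain ⟨Xt, -, Xtt, -, -, -, -, -, -, -, hX1, -, hX3, -, -, -, hX7, -⟩ :=
    exists_partials_of_contDiff_two hΦxC2
  -- identifications by uniqueness of derivatives
  have e1 : ∀ t x, φt₁ t x = Φt t x := fun t x => (h1 t x).unique (hΦt_d t x)
  have e2 : ∀ t x, φx₁ t x = Φx t x := fun t x => (h2 t x).unique (hΦx_d t x)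
  have e3 : ∀ t x, Xt t x = φtx₁ t x := by
    intro t x
    have h4' : HasDerivAt (fun τ => Φx τ x) (φtx₁ t x) t := by
      have : (fun τ => φx₁ τ x) = fun τ => Φx τ x := funext fun τ => e2 τ x
      rw [← this]; exact h4 t x
    exact (hX1 t x).unique h4'
  have e4 : ∀ t x, Tx t x = φtx₁ t x := by
    intro t x
    have h5' : HasDerivAt (Φt t) (φtx₁ t x) x := by
      have : φt₁ t = Φt t := funext fun y => e1 t y
      rw [← this]; exact h5 t x
    exact (hT2 t x).unique h5'
  -- `∂_t²∂ₓφ = ∂ₜ(∂ₜ∂ₓφ) = ∂ₜ(∂ₓ∂ₜφ) = ∂ₓ∂_t²φ`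
  have e5 : ∀ t x, Xtt t x = Ttx t x := by
    intro t x
    have hA : HasDerivAt (fun τ => Xt τ x) (Xtt t x) t := hX3 t x
    have hB : HasDerivAt (fun τ => Tx τ x) (Ttx t x) t := hT4 t x
    have : (fun τ => Xt τ x) = fun τ => Tx τ x := funext fun τ => by rw [e3, e4]
    rw [this] at hA
    exact hA.unique hB
  have e6 : ∀ t y, Tt t y = iteratedDeriv 2 (fun τ => φ τ y) t := by
    intro t y
    rw [iteratedDeriv_succ, iteratedDeriv_one]
    have : deriv (fun τ => φ τ y) = fun τ => Φt τ y := funext fun τ => (hΦt_d τ y).deriv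
    rw [this]
    exact ((hT1 t y).deriv).symm
  refine ⟨Φx, hΦxC2, hΦx_d, fun t => funext fun x => (hΦx_d t x).deriv, fun t x => ?_, fun t x => ?_⟩
  · rw [iteratedDeriv_succ' (n := 2)]
    congr 1
    exact (funext fun y => (hΦx_d t y).deriv).symm
  · rw [hX7, e5]
    have : (fun y => iteratedDeriv 2 (fun τ => φ τ y) t) = Tt t := funext fun y => (e6 t y).symm
    rw [this]
    exact ((hT5 t x).deriv).symm

end Literature.Analysis.Calculus
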